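import Summits.QuantumFields.YangMills.Theorems.BalabanUVNodesN07ChartLineFacts
import Literature.MathematicalPhysics.QuantumFieldTheory.Balaban1983to89.Node00.LinearisedAveragingAtBackground
import Literature.MathematicalPhysics.QuantumFieldTheory.Balaban1983to89.Node00.HessianOperatorAtBackground
import Literature.MathematicalPhysics.QuantumFieldTheory.Balaban1983to89.B15Claim189UnitTestAtRecord
import HarnessLib

/-!
# BalabanUVNodes ∕ N07 — THE CHART-LINE FACTS IN S1's CURRENCY: the kernel dictionary `Qlin ↔ dIterL` and the glue that turns the true chart's (iii)∕(ii-SU)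
# (`N07ChartLineFacts`) into the binders `hΦ`∕`hfib` of dag-n07-w1's criticality socket `N07SocketOfChartedCriticality.h127rec_of_isCritOnFibre`

Cell `pub-ymgap`, width seat `pub-ymgap-dag-n07-w2` generation 5 (HUMAN RULING D-0149; DAG node N07 = [15] = [Balaban1985Variational]; W-SEAT START LIST §n07 item 2 = S2
«[15] Sect. C (47)–(49), Prop. 3 at objects» — the S1∕S2 seam).  `--kind proof --supports stmt-QuantumFields-27364 --as helper` (K1⁹ face per KEY MAP v2; count-neutral).  ASKED BY
dag-n07-w1 g6 (p632841, bus 2026-08-28T11:55:53Z ∕ 12:17:53Z «consume on ACCEPT»).  CONSUMED BY NAME, nothing modified: this seat's `N07ChartLineFacts.{differentiableAt_chartLine,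
eventually_mem_weightedBall_line, exists_prop3_T4_herm0_chartLine}` (FILE 4) and `N07ChartLogReality.{coe_emlIterU_expCfg_eq_iter, I_eta_smul_mem_lieSU, neg_I_smul_mem_herm0}`
(g3); dag-n07-w1's `Node00.{dIterL, hasDerivAt_coeField_iter_expChart_smul}` (`LinearisedAveragingAtBackground`) and `Node00.TangentBondSU`; dag-n07-w2 g0's `Node00.suProj` ∕
`coe_suProj_of_mem`; n07-e's `Node00.{expChart, expChart_zero, avOfRecord, SmallBelow}`; dag-n12's `B15Claim189UnitTestAtRecord.iter_avOfRecord_one`, `T3DescentFibreTower.small_one`;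
lit-balaban `B7TransferAnalyticMean.hasFDerivAt_mlog_one`, `B15DeterminingSets.{DetSet, bondsOf, AgreeOn, avgFamily}`; UST `Prop8Chart.{chartLog_apply, coe_expCfg,
differentiableAt_chartLog_zero, collar_of_adm22}`; dag k0-s1-w2's `K0Stub1ChartDAnalytic.isOpen_weightedBall`.

THE PRINT: [15] (152) p.301 «U₁ = e^{iηA}» (the currency `X = iηA` between S1's 𝔰𝔲(N)-valued fields and the chart's Hermitian fields); (44)–(45) p.285 and (156)–(157) p.302 (the
linearised multi-level average `Q(A) = B`); (83) p.290 «QδA′ = 0» (the tangent space); [I] (0.4), (0.21) pp.253–256 (the averaging of record and its linearisation).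

WHAT IS PROVED (sorry-free; no definition; axioms standard; NODE 00's tori `F.P K`, fibre `M_N(ℂ)`, `N ≥ 1`).
§1 `smallBelow_one` (the flat field is guarded) · `inv_I_eta_smul_mem_herm0` · ★★★ `fderiv_chartLog_zero_apply_eq_dIterL` — THE KERNEL DICTIONARY
   `(D chartLog η D (0)) A (j,e) = (−i) • dIterL j 1 ((iη)•A) e` for Hermitian-traceless `A` at every `LamBond` index.
§2 ★★★ `socket_chartLine_facts` — THE GLUE (package conjuncts displayed): (iii) `DifferentiableAt ℝ (s ↦ ΦS(X₀ + s•δ)) 0` for every `δ`, and (ii) `∀ᶠ s, AgreeOn 𝔹 (avgFamily (avOfRecord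
   F N K) (expChart 1 ⇑(ΦS(X₀ + s•δ)))) (avgFamily … (expChart 1 ⇑(ΦS X₀)))` for every `𝔹` with `bondsOf (𝔹 j) ⊆ LamBond j` and every `δ` in S1's record kernel.
§3 ★★★★ `exists_socket_chartLine_facts_T4` — AT THE RECORD, NO DISPLAYED PACKAGE: for every `F : T4Family` the thresholds∕letter of `exists_prop3_T4_herm0_chartLine`; for every record datum
   and `ε` in the window: `∃ (H, Dfun)` with the Prop. 3 reality package (right inverse, (46) letter, herm0-preserving `H`, `DifferentiableOn`, per-point (55)∕(49)∕(48)∕`𝔇`∕(73), reality)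
   AND, for every base point `X₀` with `toA X₀` in the ball, the two socket binders (iii)∕(ii) for `ΦS` built from THIS `(H, Dfun)`.

HONEST FRAMING: count-neutral helper; a junction of kernel-checked theorems BY NAME plus one derivative-uniqueness computation — NO new estimate of [15]; NOT covered: the extra bonds of
`genSet` (FINDING A ∕ ME #35), the (157) identity `h157` for THIS chart's `H` (dag-n07-w1's p627407 is typed for the flat `H`; the route's `H` is the comb∕tent-corrected one), S4b's `hV`;
(58), Sects. D–F NOT here; stub 1 ∕ K0⁷ ∕ K1⁹ NOT closed; N07 NOT discharged; counts unmoved; one finite T⁴ programme at fixed ε — NOT continuum ∕ ℝ⁴ ∕ OS ∕ mass gap ∕ Clay: the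
Yang–Mills mass gap is NOT proved by any of this; R4 closes the conditional rung `BalabanLadder.UV` only.  No `sorry`, no `def`, no `instance`, no `notation`.

References: [15] T. Bałaban, CMP 102 (1985) 277–309 [Balaban1985Variational] ((44)–(48) p.285, (83) p.290, (127) p.297, (152)–(157) pp.301–302); [I] CMP 109 (1987) 249–301
[Balaban1987RG1] ((0.4) p.253, (0.21) p.256); [4] = [B7] CMP 98 (1985) 17–51 [Balaban1985Averaging] ((21) p.21, (58) p.27).
-/

noncomputable section

open scoped BigOperators Matrix.Norms.L2Operator Topology
open NormedSpace Metric Set Filter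

namespace Summit.QuantumFields.YangMills.BalabanUVNodes.N07ChartLineFactsS1

open Literature.MathematicalPhysics.QuantumFieldTheory.Balaban1983to89
open Literature.MathematicalPhysics.QuantumFieldTheory.Balaban1983to89.Node00
open T4Continuum BlockAveraging ExpMeanLog MatrixLog
open Literature.MathematicalPhysics.QuantumFieldTheory.Balaban1983to89.T4Continuum (T4Family)
open T4AdjointCovarianceUnitary (lieSU expSU coe_expSU)
open B10Eq27TorusAxialLog (unitsField toUField val_unitsField val_suIncl)
open B15DeterminingSets (DetSet MSField AgreeOn avgFamily bondsOf)
open B6SectADomainsV1 (Domains)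
open B6SectAOperatorsV1 (BondIdx)
open B9AdOrthogonal (herm0)
open Summit.QuantumFields.YangMills.Theorems.FlatCubeOpsText (Adm22)
open Summit.QuantumFields.YangMills.Theorems.K0FlatCubeOpsTextP (IsLevWeight levWeight_nonneg)
open Summit.QuantumFields.YangMills.Theorems.Prop8Chart (chartLog chartLog_apply expCfg coe_expCfg emlIterU collar_of_adm22 differentiableAt_chartLog_zero)
open Summit.QuantumFields.YangMills.Theorems.K0Stub1ChartDAnalytic (isOpen_weightedBall)
open Summit.QuantumFields.YangMills.BalabanUVNodes.N07ChartLogReality (coe_emlIterU_expCfg_eq_iter I_eta_smul_mem_lieSU neg_I_smul_mem_herm0)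
open Summit.QuantumFields.YangMills.BalabanUVNodes.N07ChartLineFacts (eventually_mem_weightedBall_line differentiableAt_chartLine exists_prop3_T4_herm0_chartLine)

variable {N : ℕ} [NeZero N]

/-! ## §1 The flat field's guard, the currency map, and the kernel dictionary `Qlin ↔ dIterL` -/

/-- The flat configuration `U = 1` is guarded below every level for the (0.4) averaging of record (`Ū^j(1) = 1`, `B15Claim189UnitTestAtRecord.iter_avOfRecord_one`, and
`T3DescentFibreTower.small_one`). [cite: Balaban1987RG1, (0.4) p.253 (bookkeeping)] -/
theorem smallBelow_one (F : T4Family) (K k : ℕ) :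
    SmallBelow (fun j => blockAvg (P := F.P K) (j := j) expMeanLogSU) k (1 : GaugeField (F.P K) 0 (SU N)) := fun j _ c => by
  have h := B15Claim189UnitTestAtRecord.iter_avOfRecord_one F N K j
  rw [show Averaging.iter (fun j => blockAvg (P := F.P K) (j := j) expMeanLogSU) j (1 : GaugeField (F.P K) 0 (SU N)) = 1 from h]
  exact T3DescentFibreTower.small_one _ c


omit [NeZero N] in
/-- The currency map `X ↦ (iη)⁻¹X` takes `𝔰𝔲(N)` to the Hermitian-traceless matrices (`(iη)⁻¹ = η⁻¹·(−i)`; `neg_I_smul_mem_herm0`). [cite: Balaban1985Variational, (152) p.301 («U₁ = e^{iηA}»)] -/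
theorem inv_I_eta_smul_mem_herm0 (η : ℝ) {Y : Matrix (Fin N) (Fin N) ℂ} (hY : Y ∈ lieSU (Fin N)) :
    (Complex.I * (η : ℂ))⁻¹ • Y ∈ herm0 (Fin N) := by
  have h : (Complex.I * (η : ℂ))⁻¹ • Y = (η⁻¹ : ℝ) • ((-Complex.I) • Y) := by
    rw [mul_inv, Complex.inv_I, mul_comm, mul_smul, ← Complex.ofReal_inv, Complex.coe_smul]
  rw [h]
  exact Submodule.smul_mem _ _ (neg_I_smul_mem_herm0 hY)


/-- ★★★ **THE KERNEL DICTIONARY BETWEEN THE CHART's LINEARISATION AND S1's LINEARISED AVERAGING**: for a nested family `D` on NODE 00's torus (`D.k = k`, (2.2)-admissible with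
`2L ≤ R′M + 1`), level weights `w`, and a HERMITIAN-TRACELESS matrix bond field `A`, at every `(j, e) ∈ BondIdx D`:
**`(D chartLog η D (0)) A (j,e) = (−i) • dIterL j 1 ((iη)•A) e`** (`η = L^{−k}`; `dIterL j 1` = dag-n07-w1's `Q_j(1) = fderiv ℝ (iterM j) 1`).  Both members are the derivative at
`s = 0` of `s ↦ chartLog η D (s•A)(j,e)`: the left by UST `differentiableAt_chartLog_zero`; the right because, for small `s`, `chartLog η D (s•A)(j,e) = (−i)•log Ū^{(j)}(e^{s·iηA})(e)`
(this seat's dictionary `coe_emlIterU_expCfg_eq_iter`), whose derivative is read from dag-n07-w1's curve form `hasDerivAt_coeField_iter_expChart_smul` at `U = 1` and `D log(1) = id`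
(`B7TransferAnalyticMean.hasFDerivAt_mlog_one`); uniqueness of derivatives.  CONSEQUENCE: S1's record kernel `∀ j e, LamBond j e → dIterL j 1 ⇑δ e = 0` is EXACTLY `Qlin ((iη)⁻¹⇑δ) = 0`.
[cite: Balaban1985Variational, (44)-(45) p.285, (83) p.290, (152)-(157) pp.301-302; Balaban1987RG1, (0.4) p.253, (0.21) p.256; Balaban1985Averaging, (21) p.21] -/
theorem fderiv_chartLog_zero_apply_eq_dIterL (F : T4Family) (K k : ℕ) (D : Domains (F.P K)) (hDk : D.k = k) {R' M : ℕ} (hAdm : Adm22 D R' M)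
    (hRM : 2 * (F.P K).L ≤ R' * M + 1) {w : ℕ → PBond (F.P K) 0 → ℝ} (hw : IsLevWeight (F.P K) k D w)
    (A : PBond (F.P K) 0 → Matrix (Fin N) (Fin N) ℂ) (hA : ∀ b, A b ∈ herm0 (Fin N)) (idx : BondIdx D) :
    (fderiv ℂ (chartLog ((((F.P K).L : ℝ)⁻¹) ^ k) D : (PBond (F.P K) 0 → Matrix (Fin N) (Fin N) ℂ) → BondIdx D → Matrix (Fin N) (Fin N) ℂ) 0) A idx =
      (-Complex.I) • dIterL (idx.1.1 : ℕ) (1 : PBond (F.P K) 0 → Matrix (Fin N) (Fin N) ℂ)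
        (fun b => (Complex.I * (((((F.P K).L : ℝ)⁻¹) ^ k : ℝ) : ℂ)) • A b) idx.1.2 := by
  set η : ℝ := (((F.P K).L : ℝ)⁻¹) ^ k with hη
  set cL := (chartLog η D : (PBond (F.P K) 0 → Matrix (Fin N) (Fin N) ℂ) → BondIdx D → Matrix (Fin N) (Fin N) ℂ) with hcL
  -- positivity bookkeeping and a dictionary radius
  have hL0 : (0 : ℝ) < (F.P K).L := by exact_mod_cast (F.P K).L_pos
  have hℓ1 : (1 : ℝ) ≤ ((((F.P K).d + 2) * (F.P K).L : ℕ) : ℝ) := by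
    exact_mod_cast Nat.one_le_iff_ne_zero.mpr (Nat.mul_ne_zero (by omega) (by have := (F.P K).hL.2; omega))
  have hden : 0 < 12800 * ((((F.P K).d + 2) * (F.P K).L : ℕ) : ℝ) ^ 2 * ((F.P K).L : ℝ) := by positivity
  obtain ⟨R, hR0, hR1, hR2⟩ : ∃ R : ℝ, 0 < R ∧ 12800 * ((((F.P K).d + 2) * (F.P K).L : ℕ) : ℝ) ^ 2 * ((F.P K).L : ℝ) * R ≤ 1 ∧
      60 * ((((F.P K).d + 2) * (F.P K).L : ℕ) : ℝ) ^ 2 * ((F.P K).L : ℝ) * R < deltaSU (Fin N) := by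
    set Cd : ℝ := 12800 * ((((F.P K).d + 2) * (F.P K).L : ℕ) : ℝ) ^ 2 * ((F.P K).L : ℝ) with hCd
    have hδ := deltaSU_pos (n := Fin N)
    refine ⟨min (1 / Cd) (deltaSU (Fin N) / (2 * Cd)), lt_min (by positivity) (by positivity), ?_, ?_⟩
    · calc Cd * min (1 / Cd) (deltaSU (Fin N) / (2 * Cd)) ≤ Cd * (1 / Cd) := mul_le_mul_of_nonneg_left (min_le_left _ _) hden.le
        _ = 1 := by field_simp
    · have h60 : 60 * ((((F.P K).d + 2) * (F.P K).L : ℕ) : ℝ) ^ 2 * ((F.P K).L : ℝ) ≤ Cd := by rw [hCd]; nlinarith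
      have hmin0 : 0 ≤ min (1 / Cd) (deltaSU (Fin N) / (2 * Cd)) := le_min (by positivity) (by positivity)
      calc 60 * ((((F.P K).d + 2) * (F.P K).L : ℕ) : ℝ) ^ 2 * ((F.P K).L : ℝ) * min (1 / Cd) (deltaSU (Fin N) / (2 * Cd))
          ≤ Cd * (deltaSU (Fin N) / (2 * Cd)) := mul_le_mul h60 (min_le_right _ _) hmin0 hden.le
        _ = deltaSU (Fin N) / 2 := by field_simp
        _ < deltaSU (Fin N) := by linarith
  have hcollar := collar_of_adm22 D hAdm hRM
  -- the `SU(N)` tangent vector `X = iηA` and the flat field's guard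
  set X : PBond (F.P K) 0 → lieSU (Fin N) := fun b => ⟨(Complex.I * (η : ℂ)) • A b, I_eta_smul_mem_lieSU η (hA b)⟩ with hX
  have hXc : ∀ b, ((X b : lieSU (Fin N)) : Matrix (Fin N) (Fin N) ℂ) = (Complex.I * (η : ℂ)) • A b := fun b => rfl
  have h1 := smallBelow_one (N := N) F K (idx.1.1 : ℕ)
  -- (a) the derivative of the chart slice through `Qlin`
  set f : ℝ → Matrix (Fin N) (Fin N) ℂ := fun s => cL (((s : ℂ)) • A) idx with hf
  have hQ : HasFDerivAt cL (fderiv ℂ cL 0) 0 := (differentiableAt_chartLog_zero η D).hasFDerivAt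
  have hl : HasDerivAt (fun s : ℝ => ((s : ℂ)) • A) A 0 := by
    simpa using (Complex.ofRealCLM.hasDerivAt (x := (0 : ℝ))).smul_const A
  have ha : HasDerivAt f ((fderiv ℂ cL 0) A idx) 0 := by
    have h1' : HasDerivAt (fun s : ℝ => cL (((s : ℂ)) • A)) ((fderiv ℂ cL 0) A) 0 :=
      HasFDerivAt.comp_hasDerivAt_of_eq (0 : ℝ) (hQ.restrictScalars ℝ) hl (by simp)
    exact ((ContinuousLinearMap.proj (R := ℝ) idx).hasFDerivAt).comp_hasDerivAt (0 : ℝ) h1'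
  -- (b) the derivative of the same slice through the record's averaging (n07-w1's curve form) and `D mlog(1) = id`
  have hcurve := hasDerivAt_coeField_iter_expChart_smul (U := (1 : GaugeField (F.P K) 0 (SU N))) (k := (idx.1.1 : ℕ)) h1 X
  have hcurve_e : HasDerivAt (fun t : ℝ => coeField (Averaging.iter (fun j => blockAvg (P := F.P K) (j := j) expMeanLogSU) (idx.1.1 : ℕ)
      (expChart (1 : GaugeField (F.P K) 0 (SU N)) (t • X))) idx.1.2)
      (dIterL (idx.1.1 : ℕ) (coeField (1 : GaugeField (F.P K) 0 (SU N)))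
        (fun b => ((1 : GaugeField (F.P K) 0 (SU N)) b : Matrix (Fin N) (Fin N) ℂ) * (X b : Matrix (Fin N) (Fin N) ℂ)) idx.1.2) 0 :=
    hasDerivAt_pi.mp hcurve idx.1.2
  have hval0 : coeField (Averaging.iter (fun j => blockAvg (P := F.P K) (j := j) expMeanLogSU) (idx.1.1 : ℕ)
      (expChart (1 : GaugeField (F.P K) 0 (SU N)) ((0 : ℝ) • X))) idx.1.2 = 1 := by
    rw [zero_smul, expChart_zero]
    have h := B15Claim189UnitTestAtRecord.iter_avOfRecord_one F N K (idx.1.1 : ℕ)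
    rw [show Averaging.iter (fun j => blockAvg (P := F.P K) (j := j) expMeanLogSU) (idx.1.1 : ℕ) (1 : GaugeField (F.P K) 0 (SU N)) = 1 from h]
    rfl
  have hmlog : HasFDerivAt (mlog : Matrix (Fin N) (Fin N) ℂ → Matrix (Fin N) (Fin N) ℂ)
      ((1 : Matrix (Fin N) (Fin N) ℂ →L[ℂ] Matrix (Fin N) (Fin N) ℂ).restrictScalars ℝ) 1 :=
    (B7TransferAnalyticMean.hasFDerivAt_mlog_one).restrictScalars ℝ
  have hb : HasDerivAt (fun t : ℝ => (-Complex.I) • mlog (coeField (Averaging.iter (fun j => blockAvg (P := F.P K) (j := j) expMeanLogSU) (idx.1.1 : ℕ)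
      (expChart (1 : GaugeField (F.P K) 0 (SU N)) (t • X))) idx.1.2))
      ((-Complex.I) • dIterL (idx.1.1 : ℕ) (coeField (1 : GaugeField (F.P K) 0 (SU N)))
        (fun b => ((1 : GaugeField (F.P K) 0 (SU N)) b : Matrix (Fin N) (Fin N) ℂ) * (X b : Matrix (Fin N) (Fin N) ℂ)) idx.1.2) 0 := by
    have h := HasFDerivAt.comp_hasDerivAt_of_eq (0 : ℝ) hmlog hcurve_e hval0.symm
    exact h.const_smul (-Complex.I)
  -- (c) the two slices agree near `0` (the dictionary along `s•A`, small `s`)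
  have hev : ∀ᶠ s : ℝ in 𝓝 0, f s = (-Complex.I) • mlog (coeField (Averaging.iter (fun j => blockAvg (P := F.P K) (j := j) expMeanLogSU) (idx.1.1 : ℕ)
      (expChart (1 : GaugeField (F.P K) 0 (SU N)) (s • X))) idx.1.2) := by
    have hball := eventually_mem_weightedBall_line w R (0 : PBond (F.P K) 0 → Matrix (Fin N) (Fin N) ℂ) A
      (fun b => by simp [hR0])
    filter_upwards [hball] with s hs
    have hs' : ∀ b, w 1 b * ‖(((s : ℂ)) • A) b‖ < R := fun b => by simpa using hs b
    have hUA : ∀ b, ((expChart (1 : GaugeField (F.P K) 0 (SU N)) (s • X) b : Matrix.specialUnitaryGroup (Fin N) ℂ) : Matrix (Fin N) (Fin N) ℂ) =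
        ((expCfg η (((s : ℂ)) • A) b : (Matrix (Fin N) (Fin N) ℂ)ˣ) : _) := by
      intro b
      have h1b : (((1 : GaugeField (F.P K) 0 (SU N)) b : Matrix.specialUnitaryGroup (Fin N) ℂ) : Matrix (Fin N) (Fin N) ℂ) = 1 := rfl
      rw [coe_expCfg]
      simp only [expChart, Submonoid.coe_mul, coe_expSU, Pi.smul_apply, Submodule.coe_smul, hXc, h1b, one_mul]
      rw [smul_comm, Complex.coe_smul]
    obtain ⟨hdict, -⟩ := coe_emlIterU_expCfg_eq_iter (N := N) k D hDk hcollar hw hR1 hR2 hs' (expChart 1 (s • X)) hUA idx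
    show cL (((s : ℂ)) • A) idx = _
    rw [hcL, chartLog_apply, hdict, val_unitsField]
    simp only [toUField, val_suIncl, coeField_apply]
  -- (d) uniqueness of the derivative
  have hb' := hb.congr_of_eventuallyEq hev
  have huniq := ha.unique hb'
  have hc1 : coeField (1 : GaugeField (F.P K) 0 (SU N)) = (1 : PBond (F.P K) 0 → Matrix (Fin N) (Fin N) ℂ) := rfl
  have hfun : (fun b => ((1 : GaugeField (F.P K) 0 (SU N)) b : Matrix (Fin N) (Fin N) ℂ) * (X b : Matrix (Fin N) (Fin N) ℂ)) =
      fun b => (Complex.I * (η : ℂ)) • A b := by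
    funext b
    have h1b : (((1 : GaugeField (F.P K) 0 (SU N)) b : Matrix.specialUnitaryGroup (Fin N) ℂ) : Matrix (Fin N) (Fin N) ℂ) = 1 := rfl
    rw [h1b, one_mul, hXc]
  rw [huniq, hc1, hfun]

/-! ## §2 The glue: (iii) and (ii) in S1's currency from a displayed chart package -/

/-- ★★★ **THE S1 GLUE — (iii) AND (ii) OF THE CRITICALITY SOCKET IN dag-n07-w1's CURRENCY, FROM A CHART PACKAGE.**  Data at NODE 00's torus `F.P K`: a nested family `D`
(`D.k = k`, `Adm22 D R′ M`, `2L ≤ R′M + 1`), level weights `w`, a radius `ε`, a ℂ-linear `H` and a chart map `Dfun` with the three conjuncts of `N07ChartLineFacts.exists_prop3_T4_herm0_chartLine`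
DISPLAYED: `DifferentiableOn ℂ Dfun` on the weighted ball, REALITY (`A′ − H(Dfun A′)` Hermitian-traceless for Hermitian-traceless `A′` in the ball) and (ii-SU).  For a base point
`X₀ : TangentBondSU` whose Hermitian representative `toA X₀ = (iη)⁻¹⇑X₀` lies in the ball, and the S1-CHART `ΦS X := toLp (b ↦ suProj((iη)•(toA X − H(Dfun(toA X)))(b)))`
(`suProj` = dag-n07-w2 g0's projection onto `𝔰𝔲(N)`, the identity on `𝔰𝔲(N)`): **(iii)** `s ↦ ΦS(X₀ + s•δ)` is differentiable at `0` for EVERY `δ`; **(ii)** for every determining set `𝔹`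
with `bondsOf (𝔹 j) ⊆ LamBond j` and every `δ` in S1's record kernel `∀ j e, LamBond j e → dIterL j 1 ⇑δ e = 0`, EVENTUALLY in `s` the configuration `exp ⇑(ΦS(X₀ + s•δ))` (background `1`)
has the same record averages as `exp ⇑(ΦS X₀)` on `𝔹`: `AgreeOn 𝔹 (avgFamily (avOfRecord F N K) (expChart 1 ⇑(ΦS(X₀ + s•δ)))) (avgFamily (avOfRecord F N K) (expChart 1 ⇑(ΦS X₀)))` — the
binders `hΦ`∕`hfib` of `N07SocketOfChartedCriticality.h127rec_of_isCritOnFibre` VERBATIM, with `W :=` the base point's averages.  (The kernel enters through §1's dictionary; the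
extra «one-end-deep» bonds of a `genSet` are NOT covered — hypothesis `bondsOf (𝔹 j) ⊆ LamBond j`, cell FINDING A.)
[cite: Balaban1985Variational, (47)-(48) p.285, (83) p.290, (127) p.297, (152)-(157) pp.301-302; Balaban1987RG1, (0.4) p.253] -/
theorem socket_chartLine_facts (F : T4Family) (K k : ℕ) (D : Domains (F.P K)) (hDk : D.k = k) {R' M : ℕ} (hAdm : Adm22 D R' M)
    (hRM : 2 * (F.P K).L ≤ R' * M + 1) {w : ℕ → PBond (F.P K) 0 → ℝ} (hw : IsLevWeight (F.P K) k D w) {ε : ℝ}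
    (H : (BondIdx D → Matrix (Fin N) (Fin N) ℂ) →ₗ[ℂ] (PBond (F.P K) 0 → Matrix (Fin N) (Fin N) ℂ))
    (Dfun : (PBond (F.P K) 0 → Matrix (Fin N) (Fin N) ℂ) → (BondIdx D → Matrix (Fin N) (Fin N) ℂ))
    (hdiff : DifferentiableOn ℂ Dfun {A' : PBond (F.P K) 0 → Matrix (Fin N) (Fin N) ℂ | ∀ b, w 1 b * ‖A' b‖ < ε})
    (hreal : ∀ A' : PBond (F.P K) 0 → Matrix (Fin N) (Fin N) ℂ, (∀ b, w 1 b * ‖A' b‖ < ε) → (∀ b, A' b ∈ herm0 (Fin N)) →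
      ∀ b, (A' - H (Dfun A')) b ∈ herm0 (Fin N))
    (hiiSU : ∀ A₀ δ : PBond (F.P K) 0 → Matrix (Fin N) (Fin N) ℂ, (∀ b, w 1 b * ‖A₀ b‖ < ε) →
      (fderiv ℂ (chartLog ((((F.P K).L : ℝ)⁻¹) ^ k) D : (PBond (F.P K) 0 → Matrix (Fin N) (Fin N) ℂ) → BondIdx D → Matrix (Fin N) (Fin N) ℂ) 0) δ = 0 →
      ∀ s : ℝ, (∀ b, w 1 b * ‖(A₀ + ((s : ℂ)) • δ) b‖ < ε) →
      ∀ (Us U0 : GaugeField (F.P K) 0 (Matrix.specialUnitaryGroup (Fin N) ℂ)),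
        (∀ b, ((Us b : Matrix.specialUnitaryGroup (Fin N) ℂ) : Matrix (Fin N) (Fin N) ℂ) =
          ((expCfg ((((F.P K).L : ℝ)⁻¹) ^ k) ((A₀ + ((s : ℂ)) • δ) - H (Dfun (A₀ + ((s : ℂ)) • δ))) b : (Matrix (Fin N) (Fin N) ℂ)ˣ) : _)) →
        (∀ b, ((U0 b : Matrix.specialUnitaryGroup (Fin N) ℂ) : Matrix (Fin N) (Fin N) ℂ) =
          ((expCfg ((((F.P K).L : ℝ)⁻¹) ^ k) (A₀ - H (Dfun A₀)) b : (Matrix (Fin N) (Fin N) ℂ)ˣ) : _)) →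
        ∀ idx : BondIdx D,
          Averaging.iter (fun _ => blockAvg expMeanLogSU) (idx.1.1 : ℕ) Us idx.1.2 =
            Averaging.iter (fun _ => blockAvg expMeanLogSU) (idx.1.1 : ℕ) U0 idx.1.2)
    (X₀ : TangentBondSU (F.P K) 0 N)
    (hX₀ : ∀ b, w 1 b * ‖(Complex.I * (((((F.P K).L : ℝ)⁻¹) ^ k : ℝ) : ℂ))⁻¹ • ((X₀ b : lieSU (Fin N)) : Matrix (Fin N) (Fin N) ℂ)‖ < ε) :
    let η : ℝ := (((F.P K).L : ℝ)⁻¹) ^ k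
    let toA : TangentBondSU (F.P K) 0 N → (PBond (F.P K) 0 → Matrix (Fin N) (Fin N) ℂ) :=
      fun X b => (Complex.I * (η : ℂ))⁻¹ • ((X b : lieSU (Fin N)) : Matrix (Fin N) (Fin N) ℂ)
    let ΦS : TangentBondSU (F.P K) 0 N → TangentBondSU (F.P K) 0 N :=
      fun X => WithLp.toLp 2 (fun b => suProj N ((Complex.I * (η : ℂ)) • ((toA X - H (Dfun (toA X))) b)))
    (∀ δ : TangentBondSU (F.P K) 0 N, DifferentiableAt ℝ (fun s : ℝ => ΦS (X₀ + s • δ)) 0) ∧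
    (∀ 𝔹 : DetSet (F.P K), (∀ (j : ℕ) (b : PBond (F.P K) j), b ∈ bondsOf (𝔹 j) → ∃ _ : j < D.k + 1, D.LamBond j b) →
      ∀ δ : TangentBondSU (F.P K) 0 N,
        (∀ (j : ℕ) (e : PBond (F.P K) j), D.LamBond j e →
          dIterL j (1 : PBond (F.P K) 0 → Matrix (Fin N) (Fin N) ℂ) (fun b => ((δ b : lieSU (Fin N)) : Matrix (Fin N) (Fin N) ℂ)) e = 0) →
        ∀ᶠ s in 𝓝 (0 : ℝ), AgreeOn 𝔹 (avgFamily (avOfRecord F N K) (expChart 1 (WithLp.ofLp (ΦS (X₀ + s • δ)))))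
          (avgFamily (avOfRecord F N K) (expChart 1 (WithLp.ofLp (ΦS X₀))))) := by
  intro η toA ΦS
  have hL0 : (0 : ℝ) < (F.P K).L := by exact_mod_cast (F.P K).L_pos
  have hη0 : η ≠ 0 := by positivity
  have hIη : (Complex.I * (η : ℂ)) ≠ 0 := mul_ne_zero Complex.I_ne_zero (by exact_mod_cast hη0)
  -- `toA` is real-affine along lines
  have hlin : ∀ (δ : TangentBondSU (F.P K) 0 N) (s : ℝ), toA (X₀ + s • δ) = toA X₀ + ((s : ℂ)) • toA δ := by
    intro δ s
    funext b
    show (Complex.I * (η : ℂ))⁻¹ • (((X₀ + s • δ) b : lieSU (Fin N)) : Matrix (Fin N) (Fin N) ℂ) =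
      (Complex.I * (η : ℂ))⁻¹ • ((X₀ b : lieSU (Fin N)) : Matrix (Fin N) (Fin N) ℂ) +
        ((s : ℂ)) • ((Complex.I * (η : ℂ))⁻¹ • ((δ b : lieSU (Fin N)) : Matrix (Fin N) (Fin N) ℂ))
    rw [PiLp.add_apply, PiLp.smul_apply, Submodule.coe_add, Submodule.coe_smul, smul_add, ← Complex.coe_smul, smul_comm]
  -- herm0-valuedness of `toA X`
  have hherm : ∀ (X : TangentBondSU (F.P K) 0 N) (b : PBond (F.P K) 0), toA X b ∈ herm0 (Fin N) := fun X b =>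
    inv_I_eta_smul_mem_herm0 η (X b).2
  have hherm_line : ∀ (δ : TangentBondSU (F.P K) 0 N) (s : ℝ) (b : PBond (F.P K) 0), (toA X₀ + ((s : ℂ)) • toA δ) b ∈ herm0 (Fin N) := by
    intro δ s b
    rw [← hlin δ s]
    exact hherm _ b
  -- the charted configuration in S1 currency has the charted matrices
  have hmat : ∀ (X : TangentBondSU (F.P K) 0 N), (∀ b, w 1 b * ‖toA X b‖ < ε) → ∀ b,
      ((expChart (1 : GaugeField (F.P K) 0 (SU N)) (WithLp.ofLp (ΦS X)) b : Matrix.specialUnitaryGroup (Fin N) ℂ) : Matrix (Fin N) (Fin N) ℂ) =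
        ((expCfg η (toA X - H (Dfun (toA X))) b : (Matrix (Fin N) (Fin N) ℂ)ˣ) : _) := by
    intro X hXε b
    have hmem : (Complex.I * (η : ℂ)) • ((toA X - H (Dfun (toA X))) b) ∈ lieSU (Fin N) :=
      I_eta_smul_mem_lieSU η (hreal (toA X) hXε (hherm X) b)
    have h1b : (((1 : GaugeField (F.P K) 0 (SU N)) b : Matrix.specialUnitaryGroup (Fin N) ℂ) : Matrix (Fin N) (Fin N) ℂ) = 1 := rfl
    rw [coe_expCfg]
    simp only [ΦS, expChart, Submonoid.coe_mul, coe_expSU, h1b, one_mul, coe_suProj_of_mem hmem]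
  refine ⟨fun δ => ?_, fun 𝔹 h𝔹 δ hker => ?_⟩
  · -- (iii): the chart line in S1 currency is a continuous-linear image of the matrix chart line
    have hΨ := differentiableAt_chartLine w ε H Dfun hdiff (toA X₀) (toA δ) hX₀
    have hΨ' : DifferentiableAt ℝ (fun s : ℝ => (Complex.I * (η : ℂ)) • ((toA X₀ + ((s : ℂ)) • toA δ) - H (Dfun (toA X₀ + ((s : ℂ)) • toA δ)))) 0 :=
      hΨ.const_smul (Complex.I * (η : ℂ))
    have hcomp : DifferentiableAt ℝ (fun s : ℝ => fun b => suProj N (((Complex.I * (η : ℂ)) •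
        ((toA X₀ + ((s : ℂ)) • toA δ) - H (Dfun (toA X₀ + ((s : ℂ)) • toA δ)))) b)) 0 :=
      differentiableAt_pi.mpr fun b => (suProj N).differentiableAt.comp (0 : ℝ) (differentiableAt_pi.mp hΨ' b)
    have htoLp : DifferentiableAt ℝ (fun s : ℝ => WithLp.toLp 2 (fun b => suProj N (((Complex.I * (η : ℂ)) •
        ((toA X₀ + ((s : ℂ)) • toA δ) - H (Dfun (toA X₀ + ((s : ℂ)) • toA δ)))) b))) 0 :=
      (PiLp.continuousLinearEquiv 2 ℝ (fun _ : PBond (F.P K) 0 => lieSU (Fin N))).symm.differentiableAt.comp (0 : ℝ) hcomp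
    have heq : (fun s : ℝ => ΦS (X₀ + s • δ)) = fun s : ℝ => WithLp.toLp 2 (fun b => suProj N (((Complex.I * (η : ℂ)) •
        ((toA X₀ + ((s : ℂ)) • toA δ) - H (Dfun (toA X₀ + ((s : ℂ)) • toA δ)))) b)) := by
      funext s
      show WithLp.toLp 2 (fun b => suProj N ((Complex.I * (η : ℂ)) • ((toA (X₀ + s • δ) - H (Dfun (toA (X₀ + s • δ)))) b))) = _
      rw [hlin δ s]
      rfl
    rw [heq]
    exact htoLp
  · -- (ii): the kernel direction has `Qlin (toA δ) = 0` (the dictionary), then (ii-SU) along the line, read on `bondsOf (𝔹 j) ⊆ LamBond`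
    have hcollar := collar_of_adm22 D hAdm hRM
    have hQ : (fderiv ℂ (chartLog η D : (PBond (F.P K) 0 → Matrix (Fin N) (Fin N) ℂ) → BondIdx D → Matrix (Fin N) (Fin N) ℂ) 0) (toA δ) = 0 := by
      funext idx
      rw [fderiv_chartLog_zero_apply_eq_dIterL (N := N) F K k D hDk hAdm hRM hw (toA δ) (hherm δ) idx, Pi.zero_apply]
      have hfun : (fun b => (Complex.I * (η : ℂ)) • toA δ b) = fun b => ((δ b : lieSU (Fin N)) : Matrix (Fin N) (Fin N) ℂ) := by
        funext b
        show (Complex.I * (η : ℂ)) • ((Complex.I * (η : ℂ))⁻¹ • ((δ b : lieSU (Fin N)) : Matrix (Fin N) (Fin N) ℂ)) = _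
        rw [smul_smul, mul_inv_cancel₀ hIη, one_smul]
      rw [hfun, hker (idx.1.1 : ℕ) idx.1.2 idx.2, smul_zero]
    have hball := eventually_mem_weightedBall_line w ε (toA X₀) (toA δ) hX₀
    filter_upwards [hball] with s hs
    have hsX : ∀ b, w 1 b * ‖toA (X₀ + s • δ) b‖ < ε := fun b => by rw [hlin δ s]; exact hs b
    have hUs := hmat (X₀ + s • δ) hsX
    have hU0 := hmat X₀ hX₀
    have hUs' : ∀ b, ((expChart (1 : GaugeField (F.P K) 0 (SU N)) (WithLp.ofLp (ΦS (X₀ + s • δ))) b : Matrix.specialUnitaryGroup (Fin N) ℂ) :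
        Matrix (Fin N) (Fin N) ℂ) = ((expCfg η ((toA X₀ + ((s : ℂ)) • toA δ) - H (Dfun (toA X₀ + ((s : ℂ)) • toA δ))) b : (Matrix (Fin N) (Fin N) ℂ)ˣ) : _) := by
      intro b; rw [hUs b, hlin δ s]
    have hagree := hiiSU (toA X₀) (toA δ) hX₀ hQ s hs _ _ hUs' hU0
    intro j b hb
    obtain ⟨hj, hlam⟩ := h𝔹 j b hb
    exact hagree ⟨⟨⟨j, hj⟩, b⟩, hlam⟩

/-! ## §3 At NODE 00's record, no displayed package -/

/-- ★★★★ **THE TWO SOCKET BINDERS AT NODE 00's RECORD, ON THE REALITY PACKAGE OF PROP. 3.**  `N07ChartLineFacts.exists_prop3_T4_herm0_chartLine`'s thresholds `M_h⁰, R₀` and letter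
`B ≥ 0`; for every admissible nested family `D` of top level `K − n` on NODE 00's torus, every level-weight family `w`, every `ε > 0` with `18C₂Bε ≤ 1`, `64ε ≤ R⋆`, `120ℓ²Lε < δ_N`:
THERE ARE `H`, `Dfun` with the reality package of [15] Prop. 3 (right inverse of `Qlin`, (46) letter `B`, `H` herm0-preserving, `DifferentiableOn`, per-point (55)∕(49)∕(48)∕`𝔇`∕(73)-norm,
reality) AND, for the S1-chart `ΦS X = toLp(b ↦ suProj((iη)•(toA X − H(Dfun(toA X)))(b)))`, `toA X = (iη)⁻¹⇑X`, `η = L^{−(K−n)}`, and EVERY base point `X₀ : TangentBondSU` with `toA X₀` in the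
weighted `ε`-ball: **(iii)** `∀ δ, DifferentiableAt ℝ (s ↦ ΦS(X₀ + s•δ)) 0` and **(ii)** `∀ 𝔹` with `bondsOf (𝔹 j) ⊆ LamBond j`, `∀ δ` in S1's record kernel,
`∀ᶠ s, AgreeOn 𝔹 (avgFamily (avOfRecord F N K) (expChart 1 ⇑(ΦS(X₀ + s•δ)))) (avgFamily (avOfRecord F N K) (expChart 1 ⇑(ΦS X₀)))` — dag-n07-w1's `hΦ`∕`hfib` for THIS chart.
[cite: Balaban1985Variational, Prop. 3 p.289, (47)-(48) p.285, (83) p.290, (127) p.297, (152)-(157) pp.301-302; Balaban1987RG1, (0.4) p.253, (0.21) p.256] -/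
theorem exists_socket_chartLine_facts_T4 (F : T4Family) :
    ∃ (Mh₀ R₀ : ℕ) (B : ℝ), 0 ≤ B ∧
    ∀ (n K : ℕ) (_ : 1 ≤ K - n) (_ : K - n + 1 ≤ F.m + K) {Mh R a' : ℕ} (_ : Mh = F.L ^ a') (_ : Mh₀ ≤ Mh) (_ : R₀ ≤ R) (_ : 2 * F.L ≤ R)
      (_ : a' + 3 ≤ F.m + n) (D : Domains (F.P K)) (_ : D.k = K - n) (_ : Adm22 D R (F.L * Mh))
      (w : ℕ → PBond (F.P K) 0 → ℝ) (_ : IsLevWeight (F.P K) (K - n) D w) {ε : ℝ} (_ : 0 < ε)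
      (_ : 18 * (960 * ((((F.P K).d + 2) * (F.P K).L : ℕ) : ℝ) * ((F.P K).L : ℝ) / (12800 * ((((F.P K).d + 2) * (F.P K).L : ℕ) : ℝ) ^ 2 * ((F.P K).L : ℝ))⁻¹) *
        B * ε ≤ 1)
      (_ : 64 * ε ≤ (12800 * ((((F.P K).d + 2) * (F.P K).L : ℕ) : ℝ) ^ 2 * ((F.P K).L : ℝ))⁻¹)
      (_ : 120 * ((((F.P K).d + 2) * (F.P K).L : ℕ) : ℝ) ^ 2 * ((F.P K).L : ℝ) * ε < deltaSU (Fin N)),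
      let η : ℝ := (((F.P K).L : ℝ)⁻¹) ^ (K - n)
      let Rs : ℝ := (12800 * ((((F.P K).d + 2) * (F.P K).L : ℕ) : ℝ) ^ 2 * ((F.P K).L : ℝ))⁻¹
      let C₂ : ℝ := 960 * ((((F.P K).d + 2) * (F.P K).L : ℕ) : ℝ) * ((F.P K).L : ℝ) / Rs
      let C₃ : ℝ := 3840 * ((((F.P K).d + 2) * (F.P K).L : ℕ) : ℝ) * ((F.P K).L : ℝ) / Rs
      let Qlin := (fderiv ℂ (chartLog η D : (PBond (F.P K) 0 → Matrix (Fin N) (Fin N) ℂ) → BondIdx D → Matrix (Fin N) (Fin N) ℂ) 0)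
      ∃ (H : (BondIdx D → Matrix (Fin N) (Fin N) ℂ) →ₗ[ℂ] (PBond (F.P K) 0 → Matrix (Fin N) (Fin N) ℂ))
        (Dfun : (PBond (F.P K) 0 → Matrix (Fin N) (Fin N) ℂ) → (BondIdx D → Matrix (Fin N) (Fin N) ℂ)),
        (∀ X, Qlin (H X) = X) ∧
        (∀ (X : BondIdx D → Matrix (Fin N) (Fin N) ℂ) (t : ℝ), 0 ≤ t → (∀ i, ‖X i‖ ≤ t) → ∀ b, w 1 b * ‖H X b‖ ≤ B * t) ∧
        (∀ X : BondIdx D → Matrix (Fin N) (Fin N) ℂ, (∀ i, X i ∈ herm0 (Fin N)) → ∀ b, H X b ∈ herm0 (Fin N)) ∧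
        DifferentiableOn ℂ Dfun {A' : PBond (F.P K) 0 → Matrix (Fin N) (Fin N) ℂ | ∀ b, w 1 b * ‖A' b‖ < ε} ∧
        (∀ A' : PBond (F.P K) 0 → Matrix (Fin N) (Fin N) ℂ, (∀ b, w 1 b * ‖A' b‖ < ε) →
          (∀ (ρ : ℝ), 0 ≤ ρ → (∀ b, w 1 b * ‖A' b‖ ≤ ρ) → ∀ i, ‖Dfun A' i‖ ≤ 4 * C₂ * ρ ^ 2) ∧
          chartLog η D (A' - H (Dfun A')) - Qlin (A' - H (Dfun A')) = Dfun A' ∧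
          chartLog η D (A' - H (Dfun A')) = Qlin A' ∧
          ∃ 𝔇 : (PBond (F.P K) 0 → Matrix (Fin N) (Fin N) ℂ) →L[ℂ] (BondIdx D → Matrix (Fin N) (Fin N) ℂ), HasFDerivAt Dfun 𝔇 A' ∧
            ∀ (W : PBond (F.P K) 0 → Matrix (Fin N) (Fin N) ℂ) (t : ℝ), 0 ≤ t → (∀ b, w 1 b * ‖W b‖ ≤ t) → ∀ i, ‖𝔇 W i‖ ≤ 4 * C₃ * ε * t) ∧
        (∀ A' : PBond (F.P K) 0 → Matrix (Fin N) (Fin N) ℂ, (∀ b, w 1 b * ‖A' b‖ < ε) → (∀ b, A' b ∈ herm0 (Fin N)) →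
          (∀ i, Dfun A' i ∈ herm0 (Fin N)) ∧ ∀ b, (A' - H (Dfun A')) b ∈ herm0 (Fin N)) ∧
        ∀ (X₀ : TangentBondSU (F.P K) 0 N),
          (∀ b, w 1 b * ‖(Complex.I * (η : ℂ))⁻¹ • ((X₀ b : lieSU (Fin N)) : Matrix (Fin N) (Fin N) ℂ)‖ < ε) →
          let toA : TangentBondSU (F.P K) 0 N → (PBond (F.P K) 0 → Matrix (Fin N) (Fin N) ℂ) :=
            fun X b => (Complex.I * (η : ℂ))⁻¹ • ((X b : lieSU (Fin N)) : Matrix (Fin N) (Fin N) ℂ)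
          let ΦS : TangentBondSU (F.P K) 0 N → TangentBondSU (F.P K) 0 N :=
            fun X => WithLp.toLp 2 (fun b => suProj N ((Complex.I * (η : ℂ)) • ((toA X - H (Dfun (toA X))) b)))
          (∀ δ : TangentBondSU (F.P K) 0 N, DifferentiableAt ℝ (fun s : ℝ => ΦS (X₀ + s • δ)) 0) ∧
          (∀ 𝔹 : DetSet (F.P K), (∀ (j : ℕ) (b : PBond (F.P K) j), b ∈ bondsOf (𝔹 j) → ∃ _ : j < D.k + 1, D.LamBond j b) →
            ∀ δ : TangentBondSU (F.P K) 0 N,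
              (∀ (j : ℕ) (e : PBond (F.P K) j), D.LamBond j e →
                dIterL j (1 : PBond (F.P K) 0 → Matrix (Fin N) (Fin N) ℂ) (fun b => ((δ b : lieSU (Fin N)) : Matrix (Fin N) (Fin N) ℂ)) e = 0) →
              ∀ᶠ s in 𝓝 (0 : ℝ), AgreeOn 𝔹 (avgFamily (avOfRecord F N K) (expChart 1 (WithLp.ofLp (ΦS (X₀ + s • δ)))))
                (avgFamily (avOfRecord F N K) (expChart 1 (WithLp.ofLp (ΦS X₀))))) := by
  obtain ⟨Mh₀, R₀, B, hB, hmain⟩ := exists_prop3_T4_herm0_chartLine (N := N) F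
  refine ⟨Mh₀, R₀, B, hB, ?_⟩
  intro n K hk1 hk' Mh R a' hMha hMh hR h2L hsize D hDk hAdm w hw ε hε h18 h64 hδN η Rs C₂ C₃ Qlin
  obtain ⟨H, Dfun, hHinv, hHB, hSH, hdiff, hA, hreal, -, -, -, -, hiiSU⟩ :=
    hmain n K hk1 hk' hMha hMh hR h2L hsize D hDk hAdm w hw hε h18 h64 hδN
  have hM1 : 1 ≤ F.L * Mh := by
    have hL := F.hL.2
    rw [hMha]; exact Nat.one_le_iff_ne_zero.mpr (Nat.mul_ne_zero (by omega) (pow_ne_zero _ (by omega)))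
  have hRM : 2 * (F.P K).L ≤ R * (F.L * Mh) + 1 := by
    have h2L' : 2 * (F.P K).L ≤ R := h2L
    have : R ≤ R * (F.L * Mh) := Nat.le_mul_of_pos_right R hM1
    omega
  refine ⟨H, Dfun, hHinv, hHB, hSH, hdiff, hA, hreal, fun X₀ hX₀ => ?_⟩
  exact socket_chartLine_facts (N := N) F K (K - n) D hDk hAdm hRM hw H Dfun hdiff (fun A' hA' hh => (hreal A' hA' hh).2) hiiSU X₀ hX₀

end Summit.QuantumFields.YangMills.BalabanUVNodes.N07ChartLineFactsS1

end
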